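import Literature.AlgebraicGeometry.Shioda1982.ExceptionalQuadruplesComplete
import HarnessLib

/-!
# Shioda 1982 / Meyer–Neutsch 1981: no exceptional quadruple at the level `N = 504` — kernel sweep, part 1 of 12

Topic `Literature/AlgebraicGeometry/Shioda1982`; companion of `ExceptionalQuadruplesComplete.lean` (search `checkB`, soundness
`tabelleOneCompleteAt_of_chunks`, invariant form `exists_mem_reps_of_isExceptionalQuadruple`, statement `TabelleOneCompleteAt`; sources,
method and framing in its module docstring) and of the series `ExceptionalQuadruplesSweep*.lean` (together: every level `2 ≤ N ≤ 180`
that is not a row of Tabelle 1; `…SweepTwoHundredTwenty/…TwoHundredSixty/…ThreeHundredForty.lean`,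
`…SweepTwoHundredFiftyTwo/…ThreeHundredNinetySix/…FourHundredSixtyEight.lean`, `…SweepTwoHundred.lean`: the levels `220, 260, 340`, `252, 396, 468`
and `200` of the families `20p`, `36p`, `40p`; `…Sweep<Level>[Part<K>].lean` for the `{2,3,5,7}`-smooth residual levels
`189, 192, 210, 216, 224, 240, 270, 288, 300, 315, 320, 324, 336, 360, 378, 384, 405, 420, 432, 448` and now `480 … 630`). THEOREMS only (no definition, no named fact): the same kernel
search at the single level `N = 504`, which carries NO row of [MeyerNeutsch1981Fermatquadrupel, Tabelle 1] (computer-generated there,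
"alle Fermatquadrupel für N ≤ 614 ermittelt", §2 p. 53) and lies above the range `N ≤ 180` of Shioda's table p. 727 — by Aoki's
Theorem C ([Aoki1983], computer-assisted for `181 ≤ m ≤ 672`) there is no exceptional element at any level `> 180`; the files
`ExceptionalQuadruplesSweepFiveHundredFourPartOne.lean`, `ExceptionalQuadruplesSweepFiveHundredFourPartTwo.lean`, `ExceptionalQuadruplesSweepFiveHundredFourPartThree.lean`, `ExceptionalQuadruplesSweepFiveHundredFourPartFour.lean`, `ExceptionalQuadruplesSweepFiveHundredFourPartFive.lean`, `ExceptionalQuadruplesSweepFiveHundredFourPartSix.lean`, `ExceptionalQuadruplesSweepFiveHundredFourPartSeven.lean`, `ExceptionalQuadruplesSweepFiveHundredFourPartEight.lean`, `ExceptionalQuadruplesSweepFiveHundredFourPartNine.lean`, `ExceptionalQuadruplesSweepFiveHundredFourPartTen.lean`, `ExceptionalQuadruplesSweepFiveHundredFourPartEleven.lean`, `ExceptionalQuadruplesSweepFiveHundredFour.lean` make the instance `N = 504` a kernel statement. The search at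
`N = 504` visits 3588018 candidate triples (`φ(504) − 1 = 143` units each), too many for one elaboration of bounded wall time, so the
chunks of first entries are spread over 12 files: `ExceptionalQuadruplesSweepFiveHundredFourPartOne.lean` — first entries `0 ≤ a < 13` (281217 candidates);
`ExceptionalQuadruplesSweepFiveHundredFourPartTwo.lean` — first entries `13 ≤ a < 27` (314467 candidates);
`ExceptionalQuadruplesSweepFiveHundredFourPartThree.lean` — first entries `27 ≤ a < 40` (298504 candidates);
`ExceptionalQuadruplesSweepFiveHundredFourPartFour.lean` — first entries `40 ≤ a < 53` (300630 candidates);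
`ExceptionalQuadruplesSweepFiveHundredFourPartFive.lean` — first entries `53 ≤ a < 66` (298729 candidates);
`ExceptionalQuadruplesSweepFiveHundredFourPartSix.lean` — first entries `66 ≤ a < 79` (292800 candidates);
`ExceptionalQuadruplesSweepFiveHundredFourPartSeven.lean` — first entries `79 ≤ a < 93` (304072 candidates);
`ExceptionalQuadruplesSweepFiveHundredFourPartEight.lean` — first entries `93 ≤ a < 107` (287494 candidates);
`ExceptionalQuadruplesSweepFiveHundredFourPartNine.lean` — first entries `107 ≤ a < 123` (301811 candidates);
`ExceptionalQuadruplesSweepFiveHundredFourPartTen.lean` — first entries `123 ≤ a < 141` (296451 candidates);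
`ExceptionalQuadruplesSweepFiveHundredFourPartEleven.lean` — first entries `141 ≤ a < 165` (306438 candidates);
`ExceptionalQuadruplesSweepFiveHundredFour.lean` — first entries `165 ≤ a < 504` (305405 candidates); the last one assembles
`completeAt_fiveHundredFour` (every sorted pair-free primitive Hodge 4-multiset mod `504` is standard) and `not_isExceptionalQuadruple_fiveHundredFour`.
WHY THIS LEVEL (cell `pub-hfermat`): `504 = 2³·3²·7`: the tree's character-sum families cover the levels `K·p`, `p` a prime above a bound depending on `K`, for
`K ∈ {2, 3, 4, 6, 8, 9, 10, 12, 18, 20, 24, 36, 40}` or `K` a power of `2` or of `3` (`PicardNumber<K>Prime.lean`, `PicardNumberTwoPowerPrime.lean`,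
`PicardNumberThreePowPrime.lean`) and the prime-power levels (`PicardNumberPrimePower.lean`); writing `504 = K·p` with `p` prime forces
`K ∈ {72, 168, 252}`, none of them among those `K`. `decide +kernel` only (no `native_decide`).

ASSEMBLY / USE (cell bookkeeping, 2026-08-25): this part is assembled into `completeAt_fiveHundredFour` and
`not_isExceptionalQuadruple_fiveHundredFour` by `ExceptionalQuadruplesSweepFiveHundredFour.lean`, which the range statement
`ExceptionalQuadruplesNoneUpTo630` (no exceptional quadruple at any level `180 < m < 631`) imports.

HONEST FRAMING (cell `pub-hfermat`): explicit algebraic cycles for specific Hodge classes on Fermat/Delsarte varieties; residual open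
instances listed; no claim on general Hodge. These classes are algebraic (Lefschetz (1,1)); certified here is only the emptiness of the
exceptional list at this level.

## References
* [MeyerNeutsch1981Fermatquadrupel] W. Meyer, W. Neutsch, *Fermatquadrupel*, Math. Ann. 256 (1981) 51–62, §2 p. 53, Tabelle 1 p. 54 (no row 504).
* [Shioda1982PicardFermat] T. Shioda, J. Fac. Sci. Univ. Tokyo IA 28 (1982) 725–734, table p. 727 (levels `≤ 180`), Prop. 4 (Q′) p. 729.
* [Aoki1983] N. Aoki, Math. Ann. 266 (1983) 23–54, Thm. C.
-/

namespace Literature.AlgebraicGeometry.Shioda1982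

open Literature.AlgebraicGeometry.HodgeTheory

set_option maxHeartbeats 0 in
/-- **The search at `N = 504` passes on the first entries `0 ≤ a < 13`** (part 1 of 12: 13 chunks, 281217 candidate
triples): every visited sorted quadruple of representatives there fails the Hodge test or is standard (`checkB`; `reps 504 = []`).
[cite: MeyerNeutsch1981Fermatquadrupel, §2 p. 53 ("alle Fermatquadrupel für N ≤ 614 ermittelt") and Tabelle 1 p. 54 (no row 504)]
[cite: Aoki1983, Thm. C] -/
theorem checkB_fiveHundredFour_partOne :
    ∀ p ∈ ([(0, 1), (1, 1), (2, 1), (3, 1), (4, 1), (5, 1), (6, 1), (7, 1), (8, 1), (9, 1), (10, 1), (11, 1), (12, 1)] : List (ℕ × ℕ)), checkB 504 p.1 p.2 = true := by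
  intro p hp
  simp only [List.mem_cons, List.not_mem_nil, or_false] at hp
  rcases hp with rfl | rfl | rfl | rfl | rfl | rfl | rfl | rfl | rfl | rfl | rfl | rfl | rfl <;> decide +kernel

end Literature.AlgebraicGeometry.Shioda1982
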